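import Literature.AlgebraicGeometry.HodgeTheory.CMHodgeGroupPowersHodgeClasses
import Literature.AlgebraicGeometry.HodgeTheory.CMHodgeGroupCrossedClasses
import HarnessLib

/-!
# `Hg = U_E` for a CM field `E = End⁰(A)` of ANY degree `2|ι|`, any multiplicities ⟹ the Hodge classes on all powers of `A` are generated by divisor classes (Moonen–Zarhin 1999 (1.8) for `D = E`, Hazama / Murty; the Lie step as a hypothesis)

Family `hodge`, layer `Literature/AlgebraicGeometry/HodgeTheory`. Research context: cell `pub-hodgeav-hg6` (LADDER-HodgeAV
PERC-SHAPE row 2, «base of HC ladder», req-37 Q2b TABLE X rows 8 / 10 / 12; HONEST FRAMING: nothing here proves HC, HC_AV or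
HC_CM; not a corollary). UNCONDITIONAL for the class of abelian varieties it names; theorems only, no definition, no named
fact (D-0026), no `sorry`. The geometric end of the coloured socket (`CMHodgeGroupSlotsHodgeClasses` = invariance under `hU`,
`CMHodgeGroupDualBases` = adapted dual bases, `CMHodgeGroupPowersHodgeClasses` = FFT assembly, `CMHodgeGroupCrossedClasses` =
`End_Hdg = ℚ[φ^*]` + crossed classes) for an ARBITRARY finite colour type `ι`: `ι = Fin 1` is the imaginary quadratic case
(this cell's `UnitaryHodgeGroupPowersHodgeClasses`, Ribet 1983), `ι = Fin 2` the quartic case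
(`QuarticCMHodgeGroupPowersHodgeClasses`), `ι = Fin 3` the sextic case (TABLE X row 12), and so on.

THE PRINT. Moonen–Zarhin 1999 (1.8) [corpus: paper:arxiv-math_9901113 p0004 L72–88]: «It was shown by Hazama and Murty
(independently) that `Hg(X) = Sp_D(V,φ)` ⟺ (`X` has no factors of type III and `D(Xⁿ) = B(Xⁿ)` for all `n`)», `Sp_D(V,φ)`
the centralizer of `D = End⁰(X)` in `Sp(V,φ)` (p0001 L99); for `D = E` a CM field `Sp_E(V,φ) = U_E(V,ψ)` ((2.3):
«`Hg(X) = U_F(V,ψ)`»), with complex points `∏_σ GL(W_σ)` over half the places (Deligne LNM 900 §4). This file is the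
direction ⟹ of (1.8) for `D = E` a CM field generated by one endomorphism `φ`, with `Hg(A) = U_E` carried as the Lie
hypothesis `hU`: every `(φ^*)_ℂ`-commuting `ψ_ℂ`-skew operator of `H¹(A(ℂ); ℂ)` lies in `Lie Hg(H¹(A)) ⊗ ℂ`.

MAIN RESULTS. **`AVSlots.isDivisorGenerated_of_hodgeLieC_cmField`**: `A` with `finrank_ℚ End⁰(A) = 2|ι|`, `φ ∈ End(A)`,
colours `μ : ι → ℂ` with `μ` injective and no `μ k'` conjugate to a `μ k` (so the `2|ι|` eigenvalues `μ k`, `conj μ k` of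
`φ^*` are pairwise distinct), `eigenMultiplicity A φ (μ k) + eigenMultiplicity A φ (conj μ k) = n₀` for every `k`, `0 < n₀`,
`dim A = |ι|·n₀` (so `E = End⁰(A) = ℚ(φ)` is commutative of degree `2|ι|` with `dim_E H¹ = n₀`), a polarization `ψ` of
`H¹(A(ℂ); ℚ)` and `hU` ⟹ `B•(B) = D•(B) ⊗ ℂ` for every `B` with slots over `A`;
`AbelianVariety.isDivisorGenerated_powSucc_of_hodgeLieC_cmField`, `AbelianVariety.isDivisorGenerated_of_hodgeLieC_cmField`,
`hodgeConjectureFor_powSucc_of_hodgeLieC_cmField`, `hodgeConjectureFor_of_isIsogenous_powSucc_of_hodgeLieC_cmField`.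
No simplicity hypothesis (the same data describe products of pairwise non-isogenous type IV factors with distinct centres).

## References

* [MoonenZarhin1999LowDim] B. Moonen, Yu. Zarhin, Math. Ann. 315 (1999) = arXiv:math/9901113, §1 (1.7)–(1.8), §2 (2.3).
* [Hazama1983] F. Hazama, Tôhoku Math. J. 35 (1983), Thm. (1.1), §3 pp. 305–306.
* [Murty1984] V. K. Murty, Math. Ann. 268 (1984), Thm. 3.1, §3.
* [Deligne1982HodgeCycles] P. Deligne, LNM 900 (1982), §4 (p. 30).
* [Milne1999LefschetzClasses] J. S. Milne, Duke Math. J. 96 (1999), Prop. 3.3, Prop. 3.6 (c).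
* [vanGeemen1994HodgeAV] B. van Geemen, LNM 1594 (1994), §2.4, Lemma 3.7.
* [MumfordAV1970] D. Mumford, *Abelian Varieties* (1970), §1 (p. 4).
-/

noncomputable section

open scoped TensorProduct Matrix
open CategoryTheory Module

namespace Literature.AlgebraicGeometry.HodgeTheory

open Literature.AlgebraicTopology.SingularHomology
open Literature.AlgebraicGeometry.Motives (IsSmoothProjective AbelianVariety bettiCohomology
  ofRatClassBaseChange ofRatClassBaseChange_tmul HodgeTensorFacts hodgeTensorFacts_holds)
open Literature.Barriers.HodgeConjecture
open Literature.AlgebraicGeometry.Motives.HodgeStructure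
open Literature.RepresentationTheory.GeneralLinear
open Literature.NumberTheory.DiophantineGeometry
open Literature.AlgebraicGeometry.ComplexMultiplication (bettiRep bettiRep_of)

section Assembly

variable {A B : AbelianVariety ℂ} {n : ℕ} {g : Fin n → (B ⟶ A)} {ι : Type} [Fintype ι] [DecidableEq ι]

/-- The two elements of `Fin 2`. [folklore] -/
private theorem fin2_cases''' (r : Fin 2) : r = 0 ∨ r = 1 := by
  fin_cases r <;> simp

/-- **`B•(B) = D•(B) ⊗ ℂ` for every abelian variety `B` with slots over `A` with `End⁰(A) = ℚ(φ)` a CM field of degree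
`2|ι|` and `Hg(A) = U_E(H¹(A;ℚ), ψ)` (Lie form `hU`), ANY multiplicities** — MZ99 (1.8) ⟹ for `D = E` (Hazama, Murty).
Hypotheses: `finrank_ℚ End⁰(A) = 2|ι|`; colours `μ : ι → ℂ`, injective, none conjugate to another or to itself;
`eigenMultiplicity A φ (μ k) + eigenMultiplicity A φ (conj μ k) = n₀` for every `k`; `0 < n₀`; `dim A = |ι| n₀`; a
polarization `ψ` of `H¹(A(ℂ); ℚ)` (Betti universe) with `hU`. Proof: the `2|ι|` eigenspaces `W_{μ k}`, `W_{conj μ k}` have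
dimension `n₀` each (`CMTheta.finrank_eigenspace_eq_add` + the multiplicity dictionary), hence are non-zero and fill
`H¹ ⊗ ℂ` (independence of eigenspaces, `2|ι| n₀ = 2 dim A`); so `End_Hdg(H¹) = ℚ[φ^*_ℚ]`
(`exists_eq_sum_smul_pow_bettiMapHom_fin`), `CMTheta.exists_adaptedDualBasis` gives adapted dual bases, and
`AVSlots.isDivisorGenerated_of_cmData_of_hodgeLieC` with the crossed classes of each colour divisorial
(`sum_cupH1_cmColour_mem_span_rational_oneOne`, `Milne1999.sum_cross_mem_span_rational_oneOne_of_eigen`) concludes.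
[cite: MoonenZarhin1999LowDim, §1 (1.8) and §2 (2.3)] [cite: Deligne1982HodgeCycles, §4 (p. 30)]
[cite: Milne1999LefschetzClasses, Prop. 3.3 and Prop. 3.6 (c)] [cite: MumfordAV1970, §1 (p. 4)] -/
theorem AVSlots.isDivisorGenerated_of_hodgeLieC_cmField [HodgeTensorFacts.{0, 0}] (hg : AVSlots A B g) (φ : A ⟶ A)
    (hE : Module.finrank ℚ A.endAlgebra = 2 * Fintype.card ι) (μ : ι → ℂ) (hinj : Function.Injective μ)
    (hdist : ∀ k k', μ k' ≠ starRingEnd ℂ (μ k)) {n₀ : ℕ} (hn₀ : 0 < n₀)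
    (hmult : ∀ k, eigenMultiplicity A φ (μ k) + eigenMultiplicity A φ (starRingEnd ℂ (μ k)) = n₀)
    (hdim : A.dim = Fintype.card ι * n₀)
    (hHD : exists_isReal_hodgeModel) (hI : hodgePQ_independent_of_hodgeModel)
    (ψ : (BettiUniverse.hodge hHD (AbelianVariety.isSmoothProjective_holds (A := A)) 1).Polarization)
    (hU : ∀ Y : Module.End ℂ (ℂ ⊗[ℚ] bettiCohomology A.X 1),
      Y * ((bettiCohomology.map φ.hom.hom.hom 1).hom).baseChange ℂ =
          ((bettiCohomology.map φ.hom.hom.hom 1).hom).baseChange ℂ * Y →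
        (∀ x y, ψ.form.baseChange ℂ (Y x) y + ψ.form.baseChange ℂ x (Y y) = 0) →
          Y ∈ (BettiUniverse.hodge hHD (AbelianVariety.isSmoothProjective_holds (A := A)) 1).hodgeLieC) :
    IsDivisorGenerated B := by
  classical
  haveI : Module.Finite ℚ (bettiCohomology A.X 1) := finite_bettiCohomology_one A
  have hX : IsSmoothProjective A.dim A.X := AbelianVariety.isSmoothProjective_holds
  have heff := BettiUniverse.hodge_isEffective hHD hX 1
  -- the rational datum `φ^*_ℚ`
  set φQ : Module.End ℚ (bettiCohomology A.X 1) := (bettiCohomology.map φ.hom.hom.hom 1).hom with hφQ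
  have hφE : φQ ∈ (BettiUniverse.hodge hHD (AbelianVariety.isSmoothProjective_holds (A := A)) 1).endAlg := by
    have h := unop_bettiRep_mem_endAlg hHD hI (AbelianVariety.endAlgebra.of A φ)
    rwa [bettiRep_of, MulOpposite.unop_op] at h
  have hVC : Module.finrank ℂ (ℂ ⊗[ℚ] bettiCohomology A.X 1) = Fintype.card (ι × Fin 2) * n₀ := by
    rw [Module.finrank_baseChange, finrank_bettiCohomology_one A, hdim, Fintype.card_prod, Fintype.card_fin]; ring
  -- the `2|ι|` eigenvalues, pairwise distinct
  set ev : ι × Fin 2 → ℂ := fun kt => if kt.2 = 0 then μ kt.1 else starRingEnd ℂ (μ kt.1) with hevdef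
  have hev0 : ∀ k, ev (k, 0) = μ k := fun k => by simp [hevdef]
  have hev1 : ∀ k, ev (k, 1) = starRingEnd ℂ (μ k) := fun k => by simp [hevdef]
  have hev : Function.Injective ev := by
    rintro ⟨k, t⟩ ⟨k', t'⟩ h
    rcases fin2_cases''' t with rfl | rfl <;> rcases fin2_cases''' t' with rfl | rfl
    · rw [hev0, hev0] at h; rw [hinj h]
    · rw [hev0, hev1] at h; exact absurd h (hdist k' k)
    · rw [hev1, hev0] at h; exact absurd h.symm (hdist k k')
    · rw [hev1, hev1] at h; rw [hinj ((starRingEnd ℂ).injective h)]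
  -- dimensions of the eigenspaces
  have hgr := fun cc => CMTheta.finrank_eigenspace_eq_add
    (BettiUniverse.hodge hHD (AbelianVariety.isSmoothProjective_holds (A := A)) 1) Nat.cast_one heff hφE cc
  have h10 : ∀ cc, Module.finrank ℂ ↥(Module.End.eigenspace (φQ.baseChange ℂ) cc ⊓
      (BettiUniverse.hodge hHD (AbelianVariety.isSmoothProjective_holds (A := A)) 1).piece 1 0) =
        eigenMultiplicity A φ cc := fun cc => by
    rw [hφQ, finrank_eigenspace_inf_piece_oneZero_eq_eigenMultiplicity hHD hI φ cc]
  have h01 : ∀ cc, Module.finrank ℂ ↥(Module.End.eigenspace (φQ.baseChange ℂ) cc ⊓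
      (BettiUniverse.hodge hHD (AbelianVariety.isSmoothProjective_holds (A := A)) 1).piece 0 1) =
        eigenMultiplicity A φ (starRingEnd ℂ cc) := fun cc => by
    rw [hφQ, finrank_eigenspace_inf_piece_zeroOne_eq_eigenMultiplicity_conj hHD hI φ cc]
  have hfin : ∀ kt, Module.finrank ℂ ↥(Module.End.eigenspace (φQ.baseChange ℂ) (ev kt)) = n₀ := by
    rintro ⟨k, t⟩
    rw [hgr, h10, h01]
    rcases fin2_cases''' t with rfl | rfl
    · rw [hev0]; exact hmult k
    · rw [hev1, starRingEnd_self_apply, add_comm]; exact hmult k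
  have hW : ∀ kt, Module.End.eigenspace (φQ.baseChange ℂ) (ev kt) ≠ ⊥ := by
    intro kt hkt
    have h := hfin kt
    rw [hkt, finrank_bot] at h
    omega
  -- `End_Hdg = ℚ[φQ]`
  have hcard : Fintype.card (ι × Fin 2) = 2 * Fintype.card ι := by
    rw [Fintype.card_prod, Fintype.card_fin, mul_comm]
  set e : ι × Fin 2 ≃ Fin (2 * Fintype.card ι) := Fintype.equivFinOfCardEq hcard with hedef
  have hEφ := exists_eq_sum_smul_pow_bettiMapHom_fin hHD hI φ hE (ev ∘ e.symm) (hev.comp e.symm.injective)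
    fun j => hW (e.symm j)
  -- `hrank` and `htop`
  have hrank : ∀ k, Module.finrank ℂ ↥(Module.End.eigenspace (φQ.baseChange ℂ) (μ k) ⊓
      (BettiUniverse.hodge hHD (AbelianVariety.isSmoothProjective_holds (A := A)) 1).piece 1 0) +
      Module.finrank ℂ ↥(Module.End.eigenspace (φQ.baseChange ℂ) (μ k) ⊓
      (BettiUniverse.hodge hHD (AbelianVariety.isSmoothProjective_holds (A := A)) 1).piece 0 1) = n₀ := fun k => by
    rw [h10, h01]; exact hmult k
  have htop : (⨆ kt : ι × Fin 2, Module.End.eigenspace (φQ.baseChange ℂ) (ev kt)) = ⊤ := by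
    have hind : iSupIndep fun kt => Module.End.eigenspace (φQ.baseChange ℂ) (ev kt) :=
      (Module.End.eigenspaces_iSupIndep (φQ.baseChange ℂ)).comp hev
    apply Submodule.eq_top_of_finrank_eq
    have h := Motives.finrank_biSup_eq_sum_of_iSupIndep hind Finset.univ
    have hs : (⨆ kt ∈ (Finset.univ : Finset (ι × Fin 2)), Module.End.eigenspace (φQ.baseChange ℂ) (ev kt)) =
        ⨆ kt, Module.End.eigenspace (φQ.baseChange ℂ) (ev kt) := by simp
    rw [hs] at h
    rw [h, hVC, Finset.sum_congr rfl fun kt _ => hfin kt, Finset.sum_const, Finset.card_univ, smul_eq_mul]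
  -- adapted dual bases and the assembly
  obtain ⟨cb, κ, hcbW, hcbW', hcb0, hcb1, hdual, hiso⟩ := CMTheta.exists_adaptedDualBasis
    (BettiUniverse.hodge hHD (AbelianVariety.isSmoothProjective_holds (A := A)) 1) Nat.cast_one heff ψ hφE hEφ μ
    hinj hdist hrank htop
  refine hg.isDivisorGenerated_of_cmData_of_hodgeLieC hHD hI ψ hU μ cb κ hcbW hcbW' hcb0 hcb1 hdual hiso
    fun j j' k => ?_
  -- the crossed classes of each colour are divisor classes
  have hθ := sum_cupH1_cmColour_mem_span_rational_oneOne hHD hI ψ φQ μ hev cb κ hcbW hcbW' hcb0 hcb1 hdual hiso k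
  simp only [cupH1_apply] at hθ
  have hneμ : μ k ≠ starRingEnd ℂ (μ k) := hdist k k
  have he : ∀ i, VanGeemen1994.pullbackOne A φ (ofRatClassBaseChange (Motives.ComplexPoints A.X) 1
      (cb ((k, 0), i))) = μ k • ofRatClassBaseChange (Motives.ComplexPoints A.X) 1 (cb ((k, 0), i)) := fun i => by
    have h := congrArg (ofRatClassBaseChange (Motives.ComplexPoints A.X) 1)
      (Module.End.mem_eigenspace_iff.1 (hcbW k i))
    rw [hφQ, ofRatClassBaseChange_baseChange_bettiMapHom, map_smul] at h
    exact h
  have hf : ∀ i, VanGeemen1994.pullbackOne A φ (ofRatClassBaseChange (Motives.ComplexPoints A.X) 1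
      (cb ((k, 1), i))) = starRingEnd ℂ (μ k) • ofRatClassBaseChange (Motives.ComplexPoints A.X) 1
        (cb ((k, 1), i)) := fun i => by
    have h := congrArg (ofRatClassBaseChange (Motives.ComplexPoints A.X) 1)
      (Module.End.mem_eigenspace_iff.1 (hcbW' k i))
    rw [hφQ, ofRatClassBaseChange_baseChange_bettiMapHom, map_smul] at h
    exact h
  exact Milne1999.sum_cross_mem_span_rational_oneOne_of_eigen φ (g j) (g j')
    (fun i => ofRatClassBaseChange (Motives.ComplexPoints A.X) 1 (cb ((k, 0), i)))
    (fun i => ofRatClassBaseChange (Motives.ComplexPoints A.X) 1 (cb ((k, 1), i))) hneμ he hf hθ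

end Assembly

section Corollaries

variable {ι : Type} [Fintype ι] [DecidableEq ι]

/-- **MZ99 (1.8) ⟹ for `D = E` a CM field of degree `2|ι|`, all powers: `B•(A^{N+1}) = D•(A^{N+1}) ⊗ ℂ`** under `hU`.
[cite: MoonenZarhin1999LowDim, §1 (1.8) and §2 (2.3)] [cite: Milne1999LefschetzClasses, Prop. 3.6 (c)] -/
theorem AbelianVariety.isDivisorGenerated_powSucc_of_hodgeLieC_cmField [HodgeTensorFacts.{0, 0}]
    (A : AbelianVariety ℂ) (φ : A ⟶ A) (hE : Module.finrank ℚ A.endAlgebra = 2 * Fintype.card ι) (μ : ι → ℂ)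
    (hinj : Function.Injective μ) (hdist : ∀ k k', μ k' ≠ starRingEnd ℂ (μ k)) {n₀ : ℕ} (hn₀ : 0 < n₀)
    (hmult : ∀ k, eigenMultiplicity A φ (μ k) + eigenMultiplicity A φ (starRingEnd ℂ (μ k)) = n₀)
    (hdim : A.dim = Fintype.card ι * n₀)
    (hHD : exists_isReal_hodgeModel) (hI : hodgePQ_independent_of_hodgeModel)
    (ψ : (BettiUniverse.hodge hHD (AbelianVariety.isSmoothProjective_holds (A := A)) 1).Polarization)
    (hU : ∀ Y : Module.End ℂ (ℂ ⊗[ℚ] bettiCohomology A.X 1),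
      Y * ((bettiCohomology.map φ.hom.hom.hom 1).hom).baseChange ℂ =
          ((bettiCohomology.map φ.hom.hom.hom 1).hom).baseChange ℂ * Y →
        (∀ x y, ψ.form.baseChange ℂ (Y x) y + ψ.form.baseChange ℂ x (Y y) = 0) →
          Y ∈ (BettiUniverse.hodge hHD (AbelianVariety.isSmoothProjective_holds (A := A)) 1).hodgeLieC)
    (N : ℕ) : IsDivisorGenerated (A.powSucc N) :=
  (AVSlots.powSucc A N).isDivisorGenerated_of_hodgeLieC_cmField φ hE μ hinj hdist hn₀ hmult hdim hHD hI ψ hU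

/-- `A` itself: `B•(A) = D•(A) ⊗ ℂ` under `hU` (CM-field centre of any degree, any multiplicities).
[cite: MoonenZarhin1999LowDim, §1 (1.8)] -/
theorem AbelianVariety.isDivisorGenerated_of_hodgeLieC_cmField [HodgeTensorFacts.{0, 0}]
    (A : AbelianVariety ℂ) (φ : A ⟶ A) (hE : Module.finrank ℚ A.endAlgebra = 2 * Fintype.card ι) (μ : ι → ℂ)
    (hinj : Function.Injective μ) (hdist : ∀ k k', μ k' ≠ starRingEnd ℂ (μ k)) {n₀ : ℕ} (hn₀ : 0 < n₀)
    (hmult : ∀ k, eigenMultiplicity A φ (μ k) + eigenMultiplicity A φ (starRingEnd ℂ (μ k)) = n₀)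
    (hdim : A.dim = Fintype.card ι * n₀)
    (hHD : exists_isReal_hodgeModel) (hI : hodgePQ_independent_of_hodgeModel)
    (ψ : (BettiUniverse.hodge hHD (AbelianVariety.isSmoothProjective_holds (A := A)) 1).Polarization)
    (hU : ∀ Y : Module.End ℂ (ℂ ⊗[ℚ] bettiCohomology A.X 1),
      Y * ((bettiCohomology.map φ.hom.hom.hom 1).hom).baseChange ℂ =
          ((bettiCohomology.map φ.hom.hom.hom 1).hom).baseChange ℂ * Y →
        (∀ x y, ψ.form.baseChange ℂ (Y x) y + ψ.form.baseChange ℂ x (Y y) = 0) →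
          Y ∈ (BettiUniverse.hodge hHD (AbelianVariety.isSmoothProjective_holds (A := A)) 1).hodgeLieC) :
    IsDivisorGenerated A :=
  (avSlots_self A).isDivisorGenerated_of_hodgeLieC_cmField φ hE μ hinj hdist hn₀ hmult hdim hHD hI ψ hU

/-- **The Hodge conjecture for all powers `A^{N+1}`** of an abelian variety with CM-field centre of degree `2|ι|` and
`Hg = U_E` (Lie form `hU`): `B = D` with Lefschetz `(1,1)` (`hodgeConjectureFor_of_isDivisorGenerated`; MZ99 (1.7)).
[cite: MoonenZarhin1999LowDim, §1 (1.7)–(1.8)] [cite: vanGeemen1994HodgeAV, §2.4] -/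
theorem hodgeConjectureFor_powSucc_of_hodgeLieC_cmField [HodgeTensorFacts.{0, 0}]
    (A : AbelianVariety ℂ) (φ : A ⟶ A) (hE : Module.finrank ℚ A.endAlgebra = 2 * Fintype.card ι) (μ : ι → ℂ)
    (hinj : Function.Injective μ) (hdist : ∀ k k', μ k' ≠ starRingEnd ℂ (μ k)) {n₀ : ℕ} (hn₀ : 0 < n₀)
    (hmult : ∀ k, eigenMultiplicity A φ (μ k) + eigenMultiplicity A φ (starRingEnd ℂ (μ k)) = n₀)
    (hdim : A.dim = Fintype.card ι * n₀)
    (hHD : exists_isReal_hodgeModel) (hI : hodgePQ_independent_of_hodgeModel)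
    (ψ : (BettiUniverse.hodge hHD (AbelianVariety.isSmoothProjective_holds (A := A)) 1).Polarization)
    (hU : ∀ Y : Module.End ℂ (ℂ ⊗[ℚ] bettiCohomology A.X 1),
      Y * ((bettiCohomology.map φ.hom.hom.hom 1).hom).baseChange ℂ =
          ((bettiCohomology.map φ.hom.hom.hom 1).hom).baseChange ℂ * Y →
        (∀ x y, ψ.form.baseChange ℂ (Y x) y + ψ.form.baseChange ℂ x (Y y) = 0) →
          Y ∈ (BettiUniverse.hodge hHD (AbelianVariety.isSmoothProjective_holds (A := A)) 1).hodgeLieC)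
    (N : ℕ) : HodgeConjectureFor (A.powSucc N).dim (A.powSucc N).X :=
  hodgeConjectureFor_of_isDivisorGenerated _ (AbelianVariety.isDivisorGenerated_powSucc_of_hodgeLieC_cmField A φ hE
    μ hinj hdist hn₀ hmult hdim hHD hI ψ hU N)

/-- **The Hodge conjecture for every complex abelian variety isogenous to a power** of an abelian variety with CM-field
centre and `Hg = U_E` (van Geemen Lemma 3.7 = the tree's `HodgeConjectureFor.of_isIsogenous`).
[cite: vanGeemen1994HodgeAV, Lemma 3.7] [cite: MoonenZarhin1999LowDim, §1 (1.8)] -/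
theorem hodgeConjectureFor_of_isIsogenous_powSucc_of_hodgeLieC_cmField [HodgeTensorFacts.{0, 0}]
    {A B' : AbelianVariety ℂ} (φ : A ⟶ A) (hE : Module.finrank ℚ A.endAlgebra = 2 * Fintype.card ι) (μ : ι → ℂ)
    (hinj : Function.Injective μ) (hdist : ∀ k k', μ k' ≠ starRingEnd ℂ (μ k)) {n₀ : ℕ} (hn₀ : 0 < n₀)
    (hmult : ∀ k, eigenMultiplicity A φ (μ k) + eigenMultiplicity A φ (starRingEnd ℂ (μ k)) = n₀)
    (hdim : A.dim = Fintype.card ι * n₀)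
    (hHD : exists_isReal_hodgeModel) (hI : hodgePQ_independent_of_hodgeModel)
    (ψ : (BettiUniverse.hodge hHD (AbelianVariety.isSmoothProjective_holds (A := A)) 1).Polarization)
    (hU : ∀ Y : Module.End ℂ (ℂ ⊗[ℚ] bettiCohomology A.X 1),
      Y * ((bettiCohomology.map φ.hom.hom.hom 1).hom).baseChange ℂ =
          ((bettiCohomology.map φ.hom.hom.hom 1).hom).baseChange ℂ * Y →
        (∀ x y, ψ.form.baseChange ℂ (Y x) y + ψ.form.baseChange ℂ x (Y y) = 0) →
          Y ∈ (BettiUniverse.hodge hHD (AbelianVariety.isSmoothProjective_holds (A := A)) 1).hodgeLieC)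
    {N : ℕ} (hB : B'.IsIsogenous (A.powSucc N)) : HodgeConjectureFor B'.dim B'.X :=
  HodgeConjectureFor.of_isIsogenous hB (hodgeConjectureFor_powSucc_of_hodgeLieC_cmField A φ hE μ hinj hdist hn₀ hmult
    hdim hHD hI ψ hU N)

end Corollaries

end Literature.AlgebraicGeometry.HodgeTheory

end
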